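/-
Copyright (c) 2026 the pub-hodgecm-mathlib formalisation cell (harness21).  Prover seat hodgecm-mathlib-K2E3-p23 (g2): Track B «K2-LIT», engine E3, line (ii′)
«H-side central germ expansion» (line lead K2E4-p06 (g2)), leaf (E) `sig_K2E3CentralGermExpansionExistence`, brick (E1) ‹U-FIN₂›; 2026-09-03.
-/
import Literature.NumberTheory.Rogawski1990.UnitaryThreeUnipotentClassesFiniteAllCM   -- ★ N = 3 pattern + the place ∕ involution ∕ norm-class bricks it imports (`exists_finset_skew_mod_norms`, `exists_mul_self_eq_of_valued_sub_one_lt_four_adicCompletion`, `smul_placesOver_eq_of_subsingleton`, `galAdicCompletionMap_galAdicCompletionMap_of_smul_eq`)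
import Literature.NumberTheory.Automorphic.UnitaryTwoUnipotentClasses                  -- ★ (F0P3a-p08 (g17)): `exists_conj_coe_eq_lineUnipotent`, `exists_conj_lineUnipotent_eq_iff_exists_norm_mul`, `exists_units_coe_eq_lineUnipotent`
import HarnessLib

/-!
# ‹U-FIN₂›: at a non-split place `v` of `L⁺`, the conjugacy classes of `H_v = U(Φ₂)(L⁺_v) × U(Φ₁)(L⁺_v)` lying over a CENTRAL element `z` with unipotent
`U(Φ₂)`-part form a FINITE set (Rogawski 1990, §3.9 p. 32 ∕ §1.10 p. 9: the classes `z`, `z·(n(t), 1)` with `t ∈ (E⁰ ∖ 0) ∕ N E^×`)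

Topic `NumberTheory/Rogawski1990`; namespace `Literature.NumberTheory.Rogawski1990`.  THEOREMS ONLY (no definition, no instance, no notation, no named fact, no `sorry`);
kernel lane `--supports stmt-HodgeConjecture-24833 --as helper`.  Cell `pub/hodgecm-mathlib` (D-0151), crux H413 = `stmt-HodgeConjecture-24833`; Track B «K2-LIT», engine E3
`K2_E3_EllipticInputs`, tier-1 unit `…Sigs_U3bCentralGerms` (ED. 3), line (ii′) «H-side central germ expansion with independent tails» (line lead K2E4-p06 (g2), MEMO
`MEMO-ii-HSideCentralGermExpansion.K2E4-p06-g2.md` 77d54c9e69b21b78), leaf **(E) `sig_K2E3CentralGermExpansionExistence`** (cand aea6e516723791cf: the STABLE, CENTRED Shalika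
germ expansion on `H_v` along the elliptic `G`-regular filter at a central `z`), brick **(E1) ‹U-FIN₂›** of K2E3-p23 (g2)'s programme (E1) ‹U-FIN₂› · (E2) ‹SPAN₂› · (E3) ‹RAO₂› ·
(E4) ‹DUAL₂› · (E5) PLUG (K2E3-plan (g1) 23:32:58Z (b); K2E4-p06 (g2) «=» 23:34:09Z (1)).
HONEST LABEL: HC_CM is proved only modulo the 7 printed citations (2 remaining named inputs: hLiu418 = stmt-HodgeConjecture-24832, h413 = stmt-HodgeConjecture-24833) until rung 0
closes; count-neutral brick: it indexes the germ expansion (E), it proves nothing printed as such.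

WHAT.  For a CM field `L`, a finite place `v` of `L⁺` with ONE place `w` of `L` above it and a CENTRAL `z = (z₁, z₂) ∈ H_v = U(Φ₂)(L⁺_v) × U(Φ₁)(L⁺_v)`, the set of conjugacy
classes `c` of `H_v` whose representative `γ_c = out c` has `γ_c · z⁻¹ = (u, 1)` with `u` unipotent (`(u − 1)² = 0` on the matrix `u ∈ GL₂(L ⊗ L⁺_v)`) is finite:
`∃ S : Finset (ConjClasses H_v), ∀ c, c ∈ S ↔ ((γ_c z⁻¹).1 − 1)² = 0 ∧ (γ_c z⁻¹).2 = 1` — the membership test is leaf (E)'s unipotent-over-`z` literal VERBATIM, so the plug's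
`S` IS this finset.
PROOF (= ★ `unitaryThree_unipotent_conjClasses_finite''`'s pattern at `N = 2`, no regular class).  One-place model `ψ : U(Φ₂)(L⁺_v) → U(σ_w, J₀)(L_w)` (★ `localNonsplitEquiv`,
`Φ₂ ⊗ 1 = J₀ = (StdForm.antidiagonal 2).over L_w`): a unipotent `g ∈ U(σ_w, J₀)` is conjugate to `n(t) = (1, t; 0, 1)` with `σ_w t = −t` (★ `exists_conj_coe_eq_lineUnipotent`),
so `g = 1` (`t = 0`) or `g ∼ n(t₀)` for `t₀` in the FINITE set `T` of skew norm-class representatives (★ `exists_finset_skew_mod_norms`, every place; ★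
`exists_conj_lineUnipotent_eq_iff_exists_norm_mul`).  Since `z₁` is central in `U(Φ₂)(L⁺_v)` and `U(Φ₁)(L⁺_v)` is untouched by conjugation with `(k, 1)`, the classes over `z`
lie in the union of the SUBSINGLETONS `A₁ = {c | ψ((γ_c).1 z₁⁻¹) = 1, (γ_c).2 = z₂}` and `A_{t₀} = {c | ψ((γ_c).1 z₁⁻¹) ∼ n(t₀), (γ_c).2 = z₂}` (`t₀ ∈ T`) — a finite set.
(Exactly which classes occur — `[L⁺_v^× : N L_w^×] = 2` — is not claimed; the brick owes finiteness only.)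

* §1 `finite_conjClasses_prod_over_central` — GENERIC: classes of a product `A × B` over `z` with `z₁` central in `A`, a predicate `P` whose solutions are `1` or
  pinned up to conjugacy by one of finitely many labels ⇒ finitely many classes `c` with `P ((γ_c).1 z₁⁻¹) ∧ (γ_c).2 = z₂` (union of subsingletons).
* §2 **`unitaryTwoOne_central_unipotent_conjClasses_finite`** — ‹U-FIN₂› (head REPORT-FIRST 2026-09-03T23:36:46Z on `K2/STATUS.md`).

## References
* [Rogawski1990] J. D. Rogawski, *Automorphic Representations of Unitary Groups in Three Variables*, Ann. of Math. Stud. 123 (1990): §1.9–§1.10 pp. 8–9 (`U(2)`, `Φ₂`,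
  `n(t)`), §3.9 p. 32 («the conjugacy class of `n(t)` is determined by `t mod NE^*`»), §4.9 p. 54 (`H = U(2) × U(1)`), §8.1 p. 112 (the index set of the germ expansion).
* [Serre1979] J.-P. Serre, *Local Fields*, GTM 67 (1979), Ch. V §2–§3 (norm groups of quadratic extensions of local fields).
* [PlatonovRapinchuk1994] V. Platonov, A. Rapinchuk, *Algebraic Groups and Number Theory* (1994), §5.1 (`U(J)(F_v) = U(σ_w, J)(E_w)` at a non-split place).
-/

set_option autoImplicit false

noncomputable section

open scoped Matrix MatrixGroups Classical
open NumberField IsDedekindDomain Matrix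

namespace Literature.NumberTheory.Rogawski1990

open Literature.NumberTheory.Automorphic Literature.NumberTheory.Automorphic.UnitaryGroup Literature.NumberTheory.GaloisRepresentations
open Literature.NumberTheory.Automorphic.HermitianLattice

/-! ## §1 Generic bookkeeping: classes of a product `A × B` over a central `z` -/

/-- **Classes of `A × B` over a central `z`, generic form.**  `z = (z₁, z₂)` with `z₁` central in `A`; a predicate `P` on `A` («unipotent») such that every `u` with `P u` is `1`
or satisfies `Q t u` for some `t` in a finite set `T` («`u ∼ n(t)`»), where `Q t` pins `u` up to `A`-conjugacy.  Then the conjugacy classes `c` of `A × B` whose representative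
`γ_c` has `P ((γ_c).1 · z₁⁻¹)` and `(γ_c).2 = z₂` form a finite set (they lie in the union of `1 + #T` subsingletons: conjugate by `(k, 1)`, `z₁` central, `B` untouched).
[cite: Rogawski1990, §3.9 p. 32; §4.9 p. 54] -/
theorem finite_conjClasses_prod_over_central {A B : Type*} [Group A] [Group B] (z : A × B) (hz1 : ∀ k : A, k * z.1 = z.1 * k)
    (P : A → Prop) {ι : Type*} (T : Finset ι) (Q : ι → A → Prop) (hQ : ∀ t u u', Q t u → Q t u' → IsConj u u')
    (hcases : ∀ u, P u → u = 1 ∨ ∃ t ∈ T, Q t u) :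
    Set.Finite {c : ConjClasses (A × B) | P ((Quotient.out c).1 * z.1⁻¹) ∧ (Quotient.out c).2 = z.2} := by
  have hout : ∀ c : ConjClasses (A × B), ConjClasses.mk (Quotient.out c) = c := fun c => by
    rw [← ConjClasses.quotient_mk_eq_mk, Quotient.out_eq]
  -- conjugacy of the `A`-parts over `z₁` + equality of the `B`-parts ⇒ equality of classes (conjugate by `(d, 1)`; `z₁` central)
  have hlift : ∀ c c' : ConjClasses (A × B), IsConj ((Quotient.out c).1 * z.1⁻¹) ((Quotient.out c').1 * z.1⁻¹) →
      (Quotient.out c).2 = z.2 → (Quotient.out c').2 = z.2 → c = c' := by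
    intro c c' hconj h2 h2'
    obtain ⟨d, hd⟩ := isConj_iff.1 hconj
    rw [← hout c, ← hout c', ConjClasses.mk_eq_mk_iff_isConj, isConj_iff]
    refine ⟨(d, 1), Prod.ext ?_ ?_⟩
    · show d * (Quotient.out c).1 * d⁻¹ = (Quotient.out c').1
      have h1 : (Quotient.out c).1 = (Quotient.out c).1 * z.1⁻¹ * z.1 := by rw [inv_mul_cancel_right]
      have h1' : (Quotient.out c').1 = (Quotient.out c').1 * z.1⁻¹ * z.1 := by rw [inv_mul_cancel_right]
      rw [h1, h1', ← hd]
      calc d * ((Quotient.out c).1 * z.1⁻¹ * z.1) * d⁻¹ = d * ((Quotient.out c).1 * z.1⁻¹) * (z.1 * d⁻¹) := by group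
        _ = d * ((Quotient.out c).1 * z.1⁻¹) * (d⁻¹ * z.1) := by rw [hz1 d⁻¹]
        _ = d * ((Quotient.out c).1 * z.1⁻¹) * d⁻¹ * z.1 := by group
    · show (1 : B) * (Quotient.out c).2 * 1⁻¹ = (Quotient.out c').2
      rw [one_mul, inv_one, mul_one, h2, h2']
  -- the subsingletons
  have hA1 : Set.Subsingleton {c : ConjClasses (A × B) | (Quotient.out c).1 * z.1⁻¹ = 1 ∧ (Quotient.out c).2 = z.2} := by
    intro c hc c' hc'
    simp only [Set.mem_setOf_eq] at hc hc'
    refine hlift c c' ?_ hc.2 hc'.2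
    rw [hc.1, hc'.1]
  have hAt : ∀ t : ι, Set.Subsingleton {c : ConjClasses (A × B) | Q t ((Quotient.out c).1 * z.1⁻¹) ∧ (Quotient.out c).2 = z.2} := by
    intro t c hc c' hc'
    simp only [Set.mem_setOf_eq] at hc hc'
    exact hlift c c' (hQ t _ _ hc.1 hc'.1) hc.2 hc'.2
  -- the classes over `z` lie in the finite union
  refine (hA1.finite.union ((T.finite_toSet).biUnion fun t _ => (hAt t).finite)).subset ?_
  intro c hc
  obtain ⟨hP, h2⟩ := hc
  simp only [Set.mem_union, Set.mem_setOf_eq, Set.mem_iUnion, exists_prop]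
  rcases hcases _ hP with h | ⟨t, htT, hq⟩
  · exact Or.inl ⟨h, h2⟩
  · exact Or.inr ⟨t, Finset.mem_coe.2 htT, hq, h2⟩

/-! ## §2 The brick ‹U-FIN₂› on the CM carriers -/

set_option maxHeartbeats 800000 in
-- statement-heavy: the product carrier `U(Φ₂)(L⁺_v) × U(Φ₁)(L⁺_v)` is spelled out in every binder
/-- **‹U-FIN₂› — THE CLASSES OF `H_v = U(Φ₂)(L⁺_v) × U(Φ₁)(L⁺_v)` OVER A CENTRAL `z` WITH UNIPOTENT `U(Φ₂)`-PART FORM A FINITE SET** (non-split `v`: one place `w` of `L`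
above `v`).  For `z ∈ Z(H_v)` there is `S : Finset (ConjClasses H_v)` with `c ∈ S ↔ (((γ_c · z⁻¹).1 − 1)² = 0 ∧ (γ_c · z⁻¹).2 = 1)`, `γ_c = out c` — leaf (E)
`sig_K2E3CentralGermExpansionExistence`'s unipotent-over-`z` literal verbatim.  One-place model `ψ`; `g` unipotent in `U(σ_w, J₀)(L_w)` ⇒ `g = 1` or `g ∼ n(t₀)`, `t₀` in the finite
skew norm-class set; `z₁` central, `U(Φ₁)` inert under `(k, 1)`-conjugation ⇒ finitely many subsingletons (§1). [cite: Rogawski1990, §3.9 p. 32; §1.10 p. 9; §4.9 p. 54]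
[cite: Serre1979, Ch. V §3 Cor. 2] [cite: PlatonovRapinchuk1994, §5.1] -/
theorem unitaryTwoOne_central_unipotent_conjClasses_finite :
    ∀ (L : Type) [Field L] [NumberField L] [IsCMField L] (v : HeightOneSpectrum (𝓞 ↥(maximalRealSubfield L))) (w : UnitaryGroup.PlacesOver L v),
      Subsingleton (UnitaryGroup.PlacesOver L v) →
      ∀ z : (cmDatum L 2 (Matrix.of fun i j : Fin 2 => if i.val + j.val + 1 = 2 then (1 : L) else 0)).Local v ×
          (cmDatum L 1 (Matrix.of fun i j : Fin 1 => if i.val + j.val + 1 = 1 then (1 : L) else 0)).Local v,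
        z ∈ Subgroup.center ((cmDatum L 2 (Matrix.of fun i j : Fin 2 => if i.val + j.val + 1 = 2 then (1 : L) else 0)).Local v ×
          (cmDatum L 1 (Matrix.of fun i j : Fin 1 => if i.val + j.val + 1 = 1 then (1 : L) else 0)).Local v) →
      ∃ S : Finset (ConjClasses ((cmDatum L 2 (Matrix.of fun i j : Fin 2 => if i.val + j.val + 1 = 2 then (1 : L) else 0)).Local v ×
          (cmDatum L 1 (Matrix.of fun i j : Fin 1 => if i.val + j.val + 1 = 1 then (1 : L) else 0)).Local v)),
        ∀ c : ConjClasses ((cmDatum L 2 (Matrix.of fun i j : Fin 2 => if i.val + j.val + 1 = 2 then (1 : L) else 0)).Local v ×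
          (cmDatum L 1 (Matrix.of fun i j : Fin 1 => if i.val + j.val + 1 = 1 then (1 : L) else 0)).Local v),
          c ∈ S ↔ ((((Quotient.out c * z⁻¹).1).val : GL (Fin 2) (UnitaryGroup.LocalRing L v)).val - 1) ^ 2 = 0 ∧ (Quotient.out c * z⁻¹).2 = 1 := by
  intro L _ _ _ v w hsub z hz
  haveI : Algebra.IsQuadraticExtension ↥(maximalRealSubfield L) L := IsCMField.isQuadraticExtension L
  -- ## 0. the place `w` is fixed by complex conjugation; the local involution `σ_w`; deep one-units are squares (every place)
  have hw : IsCMField.complexConj L • w.1 = w.1 := smul_placesOver_eq_of_subsingleton L v (IsCMField.complexConj L) hsub w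
  have hσσ : ∀ x : w.1.adicCompletion L, galAdicCompletionMap (L := L) (IsCMField.complexConj L) hw (galAdicCompletionMap (L := L) (IsCMField.complexConj L) hw x) = x :=
    galAdicCompletionMap_galAdicCompletionMap_of_smul_eq (IsCMField.complexConj L) w (IsCMField.complexConj_ne_one L) hw
  have hsq := Literature.NumberTheory.LocalFields.exists_mul_self_eq_of_valued_sub_one_lt_four_adicCompletion L w.1
  -- ## 1. the one-place model `ψ : U(Φ₂)(L⁺_v) → U(σ_w, J₀)(L_w)` (`Φ₂ ⊗ 1 = J₀`)
  have hform : placeForm (Matrix.of fun i j : Fin 2 => if i.val + j.val + 1 = 2 then (1 : L) else 0) w.1 = (StdForm.antidiagonal 2).over (w.1.adicCompletion L) := by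
    rw [placeForm, antidiagOne_map]
    exact antidiagOne_eq_over (w.1.adicCompletion L) 2
  obtain ⟨ψ, hψ⟩ : ∃ ψ : (cmDatum L 2 (Matrix.of fun i j : Fin 2 => if i.val + j.val + 1 = 2 then (1 : L) else 0)).Local v → GL (Fin 2) (w.1.adicCompletion L), ∀ y, ψ y =
      ((localNonsplitEquiv (IsCMField.complexConj L) (Matrix.of fun i j : Fin 2 => if i.val + j.val + 1 = 2 then (1 : L) else 0) (IsCMField.complexConj_ne_one L) w hw y :
        ↥(unitaryGroupOfForm (galAdicCompletionMap (L := L) (IsCMField.complexConj L) hw)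
          (placeForm (Matrix.of fun i j : Fin 2 => if i.val + j.val + 1 = 2 then (1 : L) else 0) w.1))) : GL (Fin 2) (w.1.adicCompletion L)) :=
    ⟨_, fun _ => rfl⟩
  have hψU : ∀ y, ψ y ∈ unitaryGroupOfForm (galAdicCompletionMap (L := L) (IsCMField.complexConj L) hw) ((StdForm.antidiagonal 2).over (w.1.adicCompletion L)) :=
    fun y => by rw [← hform, hψ]; exact (localNonsplitEquiv (IsCMField.complexConj L) _ (IsCMField.complexConj_ne_one L) w hw y).2
  have hψmul : ∀ y y', ψ (y * y') = ψ y * ψ y' := fun y y' => by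
    rw [hψ, hψ, hψ]
    exact congrArg Subtype.val (map_mul (localNonsplitEquiv (IsCMField.complexConj L) _ (IsCMField.complexConj_ne_one L) w hw) y y')
  have hψinv : ∀ y, ψ y⁻¹ = (ψ y)⁻¹ := fun y => by
    rw [hψ, hψ]
    exact congrArg Subtype.val (map_inv (localNonsplitEquiv (IsCMField.complexConj L) _ (IsCMField.complexConj_ne_one L) w hw) y)
  have hψone : ψ 1 = 1 := by
    rw [hψ]
    exact congrArg Subtype.val (map_one (localNonsplitEquiv (IsCMField.complexConj L) _ (IsCMField.complexConj_ne_one L) w hw))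
  have hψinj : ∀ y y', ψ y = ψ y' → y = y' := fun y y' h => by
    rw [hψ, hψ] at h
    exact (localNonsplitEquiv (IsCMField.complexConj L) _ (IsCMField.complexConj_ne_one L) w hw).injective (Subtype.ext h)
  -- conjugacy in `U(σ_w, J₀)(L_w)` pulls back along `ψ`
  have hψconj : ∀ y y' : (cmDatum L 2 (Matrix.of fun i j : Fin 2 => if i.val + j.val + 1 = 2 then (1 : L) else 0)).Local v,
      (∃ k : GL (Fin 2) (w.1.adicCompletion L), k ∈ unitaryGroupOfForm (galAdicCompletionMap (L := L) (IsCMField.complexConj L) hw)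
        ((StdForm.antidiagonal 2).over (w.1.adicCompletion L)) ∧ k * ψ y * k⁻¹ = ψ y') → IsConj y y' := by
    rintro y y' ⟨k, hk, hconj⟩
    have hk' : k ∈ unitaryGroupOfForm (galAdicCompletionMap (L := L) (IsCMField.complexConj L) hw)
        (placeForm (Matrix.of fun i j : Fin 2 => if i.val + j.val + 1 = 2 then (1 : L) else 0) w.1) := by rw [hform]; exact hk
    rw [isConj_iff]
    refine ⟨(localNonsplitEquiv (IsCMField.complexConj L) _ (IsCMField.complexConj_ne_one L) w hw).symm ⟨k, hk'⟩, hψinj _ _ ?_⟩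
    have hd : ψ ((localNonsplitEquiv (IsCMField.complexConj L) _ (IsCMField.complexConj_ne_one L) w hw).symm ⟨k, hk'⟩) = k := by
      rw [hψ, ContinuousMulEquiv.apply_symm_apply]
    rw [hψmul, hψmul, hψinv, hd, hconj]
  -- unipotency passes through `ψ`
  have hψnil : ∀ y : (cmDatum L 2 (Matrix.of fun i j : Fin 2 => if i.val + j.val + 1 = 2 then (1 : L) else 0)).Local v,
      (((y.val : GL (Fin 2) (UnitaryGroup.LocalRing L v)).val - 1) ^ 2) = 0 →
      (((ψ y : GL (Fin 2) (w.1.adicCompletion L)) : Matrix (Fin 2) (Fin 2) (w.1.adicCompletion L)) - 1) ^ 2 = 0 := by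
    intro y hy
    have h' : (Pi.evalRingHom (fun w' : PlacesOver L v => w'.1.adicCompletion L) w).mapMatrix
        ((((y.val : GL (Fin 2) (UnitaryGroup.LocalRing L v)).val - 1) ^ 2)) = 0 := by
      rw [hy, map_zero]
    rw [map_pow, map_sub, map_one, RingHom.mapMatrix_apply] at h'
    rw [hψ]
    exact h'
  -- ## 2. `z₁` is central in `U(Φ₂)(L⁺_v)`
  have hz1 : ∀ k : (cmDatum L 2 (Matrix.of fun i j : Fin 2 => if i.val + j.val + 1 = 2 then (1 : L) else 0)).Local v, k * z.1 = z.1 * k := fun k =>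
    congrArg Prod.fst (Subgroup.mem_center_iff.1 hz (k, 1))
  -- ## 3. the unipotent elements of `U(σ_w, J₀)(L_w)`: `1` or conjugate to `n(t₀)`, `t₀` in the FINITE skew norm-class set `T`
  obtain ⟨T, hT, hTrep⟩ := Literature.NumberTheory.LocalFields.exists_finset_skew_mod_norms L v w hw hsq
  have hnTex : ∀ t : (w.1.adicCompletion L), ∃ n : GL (Fin 2) (w.1.adicCompletion L), (n : Matrix (Fin 2) (Fin 2) (w.1.adicCompletion L)) = !![1, t; 0, 1] :=
    fun t => by
      obtain ⟨n, hn, -⟩ := exists_units_coe_eq_lineUnipotent (K := w.1.adicCompletion L) t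
      exact ⟨n, hn⟩
  choose nT hnT using hnTex
  have hsing : ∀ g : GL (Fin 2) (w.1.adicCompletion L), g ∈ unitaryGroupOfForm (galAdicCompletionMap (L := L) (IsCMField.complexConj L) hw) ((StdForm.antidiagonal 2).over (w.1.adicCompletion L)) →
      ((g : Matrix (Fin 2) (Fin 2) (w.1.adicCompletion L)) - 1) ^ 2 = 0 →
      g = 1 ∨ ∃ t ∈ T, ∃ k : GL (Fin 2) (w.1.adicCompletion L), k ∈ unitaryGroupOfForm (galAdicCompletionMap (L := L) (IsCMField.complexConj L) hw) ((StdForm.antidiagonal 2).over (w.1.adicCompletion L)) ∧ k * g * k⁻¹ = nT t := by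
    intro g hg hsq2
    obtain ⟨k, hk, t', hσt', hshape⟩ := exists_conj_coe_eq_lineUnipotent (galAdicCompletionMap (L := L) (IsCMField.complexConj L) hw) hσσ hg ⟨2, hsq2⟩
    by_cases ht' : t' = 0
    · left
      have h1 : k * g * k⁻¹ = 1 := Units.ext (by
        rw [hshape, ht', Units.val_one]; ext i j; fin_cases i <;> fin_cases j <;> rfl)
      calc g = k⁻¹ * (k * g * k⁻¹) * k := by group
        _ = 1 := by rw [h1, mul_one, inv_mul_cancel]
    · right
      have hσt'' : galAdicCompletionMap (L := L) (IsCMField.complexConj L) hw t' = -t' := eq_neg_of_add_eq_zero_left hσt'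
      obtain ⟨t, htT, x, hx0, ht'eq⟩ := hTrep t' hσt'' ht'
      have ht0 : t ≠ 0 := (hT t htT).2
      obtain ⟨k', hk', hconj⟩ := (exists_conj_lineUnipotent_eq_iff_exists_norm_mul (galAdicCompletionMap (L := L) (IsCMField.complexConj L) hw) hσσ ht0 (hnT t) hshape).2
        ⟨x, hx0, ht'eq⟩
      exact ⟨t, htT, k'⁻¹ * k, mul_mem (inv_mem hk') hk, by
        rw [show k'⁻¹ * k * g * (k'⁻¹ * k)⁻¹ = k'⁻¹ * (k * g * k⁻¹) * k' by group, ← hconj]; group⟩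
  -- ## 4. §1 on `H_v = U(Φ₂)(L⁺_v) × U(Φ₁)(L⁺_v)` with `P u := (u − 1)² = 0`, `Q t u := ψ u ∼ n(t)`
  have hfin := finite_conjClasses_prod_over_central z hz1
    (fun u : (cmDatum L 2 (Matrix.of fun i j : Fin 2 => if i.val + j.val + 1 = 2 then (1 : L) else 0)).Local v =>
      (((u.val : GL (Fin 2) (UnitaryGroup.LocalRing L v)).val - 1) ^ 2) = 0)
    T (fun t u => ∃ k : GL (Fin 2) (w.1.adicCompletion L), k ∈ unitaryGroupOfForm (galAdicCompletionMap (L := L) (IsCMField.complexConj L) hw)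
        ((StdForm.antidiagonal 2).over (w.1.adicCompletion L)) ∧ k * ψ u * k⁻¹ = nT t)
    (by
      rintro t u u' ⟨k, hk, hkc⟩ ⟨k', hk', hkc'⟩
      refine hψconj u u' ⟨k'⁻¹ * k, mul_mem (inv_mem hk') hk, ?_⟩
      calc k'⁻¹ * k * ψ u * (k'⁻¹ * k)⁻¹ = k'⁻¹ * (k * ψ u * k⁻¹) * k' := by group
        _ = k'⁻¹ * (k' * ψ u' * k'⁻¹) * k' := by rw [hkc, hkc']
        _ = ψ u' := by group)
    (by
      intro u hu
      rcases hsing _ (hψU u) (hψnil u hu) with h | ⟨t, htT, h⟩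
      · exact Or.inl (hψinj _ _ (by rw [h, hψone]))
      · exact Or.inr ⟨t, htT, h⟩)
  have hfin' : Set.Finite {c : ConjClasses ((cmDatum L 2 (Matrix.of fun i j : Fin 2 => if i.val + j.val + 1 = 2 then (1 : L) else 0)).Local v ×
      (cmDatum L 1 (Matrix.of fun i j : Fin 1 => if i.val + j.val + 1 = 1 then (1 : L) else 0)).Local v) |
      ((((Quotient.out c * z⁻¹).1).val : GL (Fin 2) (UnitaryGroup.LocalRing L v)).val - 1) ^ 2 = 0 ∧ (Quotient.out c * z⁻¹).2 = 1} :=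
    hfin.subset fun c hc => ⟨hc.1, mul_inv_eq_one.1 hc.2⟩
  exact ⟨hfin'.toFinset, fun c => by rw [Set.Finite.mem_toFinset, Set.mem_setOf_eq]⟩

end Literature.NumberTheory.Rogawski1990

end
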